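import Summits.QuantumFields.YangMills.Theorems.BalabanUVNodesPortS1JacTorusRows

/-!
# NODE O port PT-A — ROWS (a)(b) OF `stub_LZjac` OFF THE WRAP CLASS: the integer formula `Ψ_jac` read through the cover IS the torus piece — `Ψ_jac(X̂_K(X))(φ ∘ π) = E_T(X, φ)` for
# `X ∉ recordWrapCtr` — by the BIJECTION `ĉ ↦ π_{k+1} ĉ` between the integer coarse bonds of `X̂_K(X)` and the torus coarse bonds `c` with `X(c) = X` (injective on the centred
# window, onto by the centred lift of the cube of `c₋`), summed against the universal-cover bridge `J_T(π ĉ, 𝐔) = J_ℤ(ĉ, 𝐔 ∘ π)`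

Cell `ym-nodeO-ideate`, porter seat `ymgap-nodeO-port-PTA-1` (gen 6); `--supports stmt-QuantumFields-27930` (helper); ✓ `…JacPiecesDefs`, `…JacCoverDeriv`, `…JacDomGeom`, `…JacTorusRows`,
gen 2's centred window geometry ✓ `…PortS1LocalFormula` (`two_mul_abs_lt_of_mem_cubeExt_valMinAbs`), DEF-1 ✓ `…K0RecordFormatNamesLemmas2` (`valMinAbs_add_one_of_ne_half`, `mem_recordWrapCtr_iff`).
[I] = [Balaban1987RG1].  Print: (1.21) p.264 «T^{(j+1)} ↗ Z^d … by the localized representation (1.7)».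
* `cubeOfSite_coverAt` (`cubeOfSite (π y) = proj ⌊y∕Mc⌋`), `proj_valMinAbs`, `two_mul_abs_lt_of_mem_blockSites_valMinAbs`, `coverAt_injOn_blockSites_intCubes` (injectivity off the wrap class),
  `domOfBond_coverBondAt_of_mem_coarseBondsOf` (maps-to), ★ `exists_mem_coarseBondsOf_coverBondAt_eq` (onto), ★★★ `ΨjacRaw_intCubes_pullPair`, `piece_ΨjacRaw_eq_jacPieceT`,
  ★★ `analyticOnUcOff_ΨjacRaw`, ★★ `bound118OnUcOff_ΨjacRaw` (rows (a)(b) OFF the wrap class from the per-bond rows of `JacRowsAB`, `E₁ = 8 Mc⁴ E e^κ`).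

HONEST FRAMING.  Integer ∕ torus bookkeeping; rows (a)(b) DERIVED FROM DISPLAYED per-bond hypotheses; NOTHING of Bałaban's estimates asserted, ported or discharged; `stub_LZjac` OPEN; 27930 OPEN ·
no claim; K0⁷∕K-Ax OPEN; NODE O 0∕1; COUNT 8∕28 · K 1∕4 UNMOVED; finite `𝕋⁴_{L^K}` at fixed ε — NOT continuum ∕ OS ∕ Clay; **the Yang–Mills mass gap is NOT proved by any of this.**  No `sorry`,
no `def`, no `instance`, no `notation`; standard axioms.
-/

noncomputable section

open scoped BigOperators Matrix.Norms.L2Operator Topology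

namespace Summit.QuantumFields.YangMills.Theorems.BalabanUVNodesPortS1

open Summit.QuantumFields.YangMills.Theorems.K0RecordFormatNames
open Literature.MathematicalPhysics.QuantumFieldTheory.Balaban1983to89
open Literature.MathematicalPhysics.QuantumFieldTheory.Balaban1983to89.Node00
open Literature.MathematicalPhysics.QuantumFieldTheory.Balaban1983to89.T4Continuum (T4Family Letter LStep)
open Literature.MathematicalPhysics.QuantumFieldTheory.Balaban1983to89.B7Prop1Explicit (e e_apply)
open Literature.MathematicalPhysics.QuantumFieldTheory.Balaban1983to89.BlockAveragingZd (IdxZ offZ)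
open Literature.MathematicalPhysics.QuantumFieldTheory.Balaban1983to89.B15Eq112TorusCover (cover)
open Literature.MathematicalPhysics.QuantumFieldTheory.Balaban1983to89.B14.Eq213MaximalDomains (cubeExt side)
open Literature.MathematicalPhysics.QuantumFieldTheory.Balaban1983to89.TreeLengthTorus (TPt IsTDom)
open Literature.MathematicalPhysics.QuantumLattice (blockMap blockSites mem_blockSites_iff)
open _root_.Matrix

/-! ## §1  Cubes under the cover; the integer coarse bonds of `X̂_K(X)` versus the torus coarse bonds of `X`, off the wrap class -/

section OffWrap

variable (F : T4Family)

variable {F} in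
/-- **The cube of a covered level-`(k+1)` site is the cover of the integer `Mc`-block index**: `cubeOfSite (π_{k+1} y) = proj_q ⌊y ∕ Mc⌋` (tiled range, `N_{k+1} = q·Mc`).
[cite: Balaban1987RG1, p.257, (1.21) p.264 (bookkeeping)] -/
theorem cubeOfSite_coverAt {Mc k K : ℕ} (hMc : McGuard F Mc) (hK : recordK₀ F Mc k ≤ K) (y : Fin (F.P K).d → ℤ) :
    cubeOfSite F Mc k K (coverAt (F.P K) (k + 1) y) = TreeLengthTorus.proj (Sect2.domCount (F.P K) Mc (k + 1)) (blockMap Mc y) := by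
  have hMc0 : 0 < Mc := by obtain ⟨c, rfl⟩ := hMc; exact pow_pos (by have := F.hL.2; omega) _
  have hN := PortHRecordRowG.sitesPerDir_eq_domCount_mul hMc hK
  have hNz : (((F.P K).sitesPerDir (k + 1) : ℕ) : ℤ) = (Sect2.domCount (F.P K) Mc (k + 1) : ℤ) * (Mc : ℤ) := by
    rw [hN, Nat.cast_mul]
  funext i
  show ((((y i : ℤ) : ZMod ((F.P K).sitesPerDir (k + 1))).val / Mc : ℕ) : ZMod (Sect2.domCount (F.P K) Mc (k + 1))) =
    (((y i / (Mc : ℤ) : ℤ)) : ZMod (Sect2.domCount (F.P K) Mc (k + 1)))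
  have hv : ((((y i : ℤ) : ZMod ((F.P K).sitesPerDir (k + 1))).val : ℤ)) = y i % (((F.P K).sitesPerDir (k + 1) : ℕ) : ℤ) := ZMod.val_intCast _
  have e1 : y i - (Sect2.domCount (F.P K) Mc (k + 1) : ℤ) * (Mc : ℤ) * (y i / ((Sect2.domCount (F.P K) Mc (k + 1) : ℤ) * (Mc : ℤ))) =
      y i + (Mc : ℤ) * (-((Sect2.domCount (F.P K) Mc (k + 1) : ℤ) * (y i / ((Sect2.domCount (F.P K) Mc (k + 1) : ℤ) * (Mc : ℤ))))) := by ring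
  rw [← Int.cast_natCast (R := ZMod (Sect2.domCount (F.P K) Mc (k + 1))), Int.natCast_div, hv, Int.emod_def, hNz, e1,
    Int.add_mul_ediv_left _ _ (by exact_mod_cast hMc0.ne'), Int.cast_add, Int.cast_neg, Int.cast_mul, Int.cast_natCast, ZMod.natCast_self, zero_mul,
    neg_zero, add_zero]

/-- The cover of the `valMinAbs` representatives is the identity on cube indices. [cite: Balaban1987RG1, (1.21) p.264 (bookkeeping)] -/
theorem proj_valMinAbs {d q : ℕ} (a : TPt d q) : TreeLengthTorus.proj q (fun i => (a i).valMinAbs) = a := by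
  funext i
  exact ZMod.coe_valMinAbs (a i)

variable {F} in
/-- **OFF THE WRAP CLASS, the integer sites of the `Mc`-blocks of `X̂_K(X)` lie in the centred window of the level-`(k+1)` torus**: `2|y_i| < N_{k+1}`.
[cite: Balaban1987RG1, (1.21) p.264] -/
theorem two_mul_abs_lt_of_mem_blockSites_valMinAbs {Mc k K : ℕ} (hMc : McGuard F Mc) (hK : recordK₀ F Mc k ≤ K)
    (x : TPt (F.P K).d (Sect2.domCount (F.P K) Mc (k + 1))) (hx : ¬ OnSeamCtr x) {y : Fin (F.P K).d → ℤ} (hy : y ∈ blockSites Mc (fun i => (x i).valMinAbs)) (i : Fin (F.P K).d) :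
    2 * |y i| < (((F.P K).sitesPerDir (k + 1) : ℕ) : ℤ) := by
  have hMc0 : 0 < Mc := by obtain ⟨c, rfl⟩ := hMc; exact pow_pos (by have := F.hL.2; omega) _
  haveI : NeZero Mc := ⟨hMc0.ne'⟩
  have hk : k + 1 ≤ (F.P K).m + (F.P K).K := by rw [F.P_K]; unfold recordK₀ at hK; omega
  have hLk : (0 : ℤ) < (F.L : ℤ) ^ (k + 1) := by have := F.hL.2; positivity
  rw [mem_blockSites_iff] at hy
  -- the fine point `L^{k+1} · y` lies in the `s`-cube of integer index `valMinAbs ∘ x`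
  have hz : (fun j => (F.L : ℤ) ^ (k + 1) * y j) ∈ cubeExt (F.L ^ (k + 1) * Mc) (fun j => (x j).valMinAbs) 0 := by
    intro j
    have hyj := congrFun hy j
    simp only [blockMap] at hyj
    have h1 := Int.emod_add_mul_ediv (y j) (Mc : ℤ)
    have h2 := Int.emod_nonneg (y j) (by exact_mod_cast hMc0.ne' : (Mc : ℤ) ≠ 0)
    have h3 := Int.emod_lt_of_pos (y j) (by exact_mod_cast hMc0 : (0 : ℤ) < Mc)
    rw [hyj] at h1
    simp only [sub_zero, add_zero]
    push_cast
    constructor <;> nlinarith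
  have h := two_mul_abs_lt_of_mem_cubeExt_valMinAbs hMc hK x hx hz i
  rw [TreeLengthTorus.sitesPerDir_eq_pow_mul (F.P K) (Nat.zero_le (k + 1)) hk, Nat.sub_zero] at h
  push_cast at h
  rw [abs_mul, abs_of_pos hLk] at h
  have : (F.L : ℤ) ^ (k + 1) * (2 * |y i|) < (F.L : ℤ) ^ (k + 1) * ((F.P K).sitesPerDir (k + 1) : ℕ) := by
    have e : ((F.P K).L : ℤ) = F.L := rfl
    rw [e] at h; linarith
  exact lt_of_mul_lt_mul_left this hLk.le

variable {F} in
/-- `π_{k+1}` is injective on the integer sites of the blocks of `X̂_K(X)`, off the wrap class. [cite: Balaban1987RG1, (1.21) p.264] -/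
theorem coverAt_injOn_blockSites_intCubes {Mc k K : ℕ} (hMc : McGuard F Mc) (hK : recordK₀ F Mc k ≤ K) {X : (recordDomSys F Mc k K).Dom}
    (hX : X ∉ recordWrapCtr F Mc k K) {y y' : Fin (F.P K).d → ℤ} (hy : y ∈ (intCubes F Mc k K X).biUnion fun a => blockSites Mc a)
    (hy' : y' ∈ (intCubes F Mc k K X).biUnion fun a => blockSites Mc a) (h : coverAt (F.P K) (k + 1) y = coverAt (F.P K) (k + 1) y') : y = y' := by
  rw [mem_recordWrapCtr_iff] at hX
  push Not at hX
  have hwin : ∀ {w : Fin (F.P K).d → ℤ}, w ∈ (intCubes F Mc k K X).biUnion (fun a => blockSites Mc a) → ∀ i, 2 * |w i| < (((F.P K).sitesPerDir (k + 1) : ℕ) : ℤ) := by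
    intro w hw i
    obtain ⟨a, ha, hwa⟩ := Finset.mem_biUnion.1 hw
    have ha' : a ∈ (X.1 : Finset _).image (fun c i => (c i).valMinAbs) := ha
    obtain ⟨x, hx, rfl⟩ := Finset.mem_image.1 ha'
    exact two_mul_abs_lt_of_mem_blockSites_valMinAbs hMc hK x (hX x hx) hwa i
  funext i
  have hdvd : (((F.P K).sitesPerDir (k + 1) : ℕ) : ℤ) ∣ y' i - y i := (ZMod.intCast_eq_intCast_iff_dvd_sub (y i) (y' i) _).1 (congrFun h i)
  have h1 := hwin hy i
  have h2 := hwin hy' i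
  have habs : |y' i - y i| < (((F.P K).sitesPerDir (k + 1) : ℕ) : ℤ) := by
    have := abs_sub (y' i) (y i); linarith
  have := Int.eq_zero_of_abs_lt_dvd hdvd habs
  linarith

variable {F} in
/-- **Every integer coarse bond of `X̂_K(X)` covers a coarse bond of the fibre of `X`** (any range for the set identity; tiled range for `domOfBond_val`).
[cite: Balaban1987RG1, (1.21) p.264, (1.7) p.261] -/
theorem domOfBond_coverBondAt_of_mem_coarseBondsOf {Mc k K : ℕ} (hMc : McGuard F Mc) (hK : recordK₀ F Mc k ≤ K) (X : (recordDomSys F Mc k K).Dom)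
    {ĉ : (Fin (F.P K).d → ℤ) × Fin (F.P K).d} (hĉ : ĉ ∈ coarseBondsOf Mc (intCubes F Mc k K X)) : domOfBond F Mc k K (coverBondAt (F.P K) (k + 1) ĉ) = X := by
  classical
  have hcube : cubesetZ Mc ĉ = intCubes F Mc k K X := (Finset.mem_filter.1 hĉ).2
  apply Subtype.ext
  rw [domOfBond_val hMc hK, coverBondAt_tgt]
  show ({cubeOfSite F Mc k K (coverAt (F.P K) (k + 1) ĉ.1), cubeOfSite F Mc k K (coverAt (F.P K) (k + 1) (ĉ.1 + e ĉ.2))} : Finset _) = X.1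
  rw [cubeOfSite_coverAt hMc hK, cubeOfSite_coverAt hMc hK]
  have himg : ({TreeLengthTorus.proj (Sect2.domCount (F.P K) Mc (k + 1)) (blockMap Mc ĉ.1),
      TreeLengthTorus.proj (Sect2.domCount (F.P K) Mc (k + 1)) (blockMap Mc (ĉ.1 + e ĉ.2))} : Finset _) =
      (cubesetZ Mc ĉ).image (TreeLengthTorus.proj (Sect2.domCount (F.P K) Mc (k + 1))) := by
    unfold cubesetZ
    rw [Finset.image_insert, Finset.image_singleton]
  rw [himg, hcube]
  ext x
  constructor
  · intro hx
    obtain ⟨a, ha, rfl⟩ := Finset.mem_image.1 hx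
    have ha' : a ∈ (X.1 : Finset _).image (fun c i => (c i).valMinAbs) := ha
    obtain ⟨x', hx', rfl⟩ := Finset.mem_image.1 ha'
    rw [proj_valMinAbs]; exact hx'
  · intro hx
    refine Finset.mem_image.2 ⟨fun i => (x i).valMinAbs, ?_, proj_valMinAbs x⟩
    exact Finset.mem_image.2 ⟨x, hx, rfl⟩

variable {F} in
/-- **Every coarse bond of the fibre of `X` is covered by an integer coarse bond of `X̂_K(X)`, off the wrap class** (the centred lift of the cube of `c₋`, the remainders of `c₋` kept).
[cite: Balaban1987RG1, (1.21) p.264, (1.7) p.261] -/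
theorem exists_mem_coarseBondsOf_coverBondAt_eq {Mc k K : ℕ} (hMc : McGuard F Mc) (hK : recordK₀ F Mc k ≤ K) {X : (recordDomSys F Mc k K).Dom}
    (hX : X ∉ recordWrapCtr F Mc k K) (c : PBond (F.P K) (k + 1)) (hc : domOfBond F Mc k K c = X) :
    ∃ ĉ ∈ coarseBondsOf Mc (intCubes F Mc k K X), coverBondAt (F.P K) (k + 1) ĉ = c := by
  classical
  have hMc0 : 0 < Mc := by obtain ⟨c, rfl⟩ := hMc; exact pow_pos (by have := F.hL.2; omega) _
  haveI : NeZero Mc := ⟨hMc0.ne'⟩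
  have hN := PortHRecordRowG.sitesPerDir_eq_domCount_mul hMc hK
  rw [mem_recordWrapCtr_iff] at hX
  push Not at hX
  have hXval : X.1 = {cubeOfSite F Mc k K c.src, cubeOfSite F Mc k K c.tgt} := by rw [← hc, domOfBond_val hMc hK]
  have hsrc_off : ¬ OnSeamCtr (cubeOfSite F Mc k K c.src) := hX _ (by rw [hXval]; exact Finset.mem_insert_self _ _)
  -- the lift
  set a := cubeOfSite F Mc k K c.src with ha
  set ŷ : Fin (F.P K).d → ℤ := fun i => (Mc : ℤ) * (a i).valMinAbs + (((c.src i).val % Mc : ℕ) : ℤ) with hŷ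
  have hrem : ∀ i, ((c.src i).val % Mc : ℕ) < Mc := fun i => Nat.mod_lt _ hMc0
  have hMc0z : (Mc : ℤ) ≠ 0 := by exact_mod_cast hMc0.ne'
  -- (1) its `Mc`-block is the centred representative of the cube of `c₋`
  have hblk : blockMap Mc ŷ = fun i => (a i).valMinAbs := by
    funext i
    show ((Mc : ℤ) * (a i).valMinAbs + (((c.src i).val % Mc : ℕ) : ℤ)) / (Mc : ℤ) = (a i).valMinAbs
    rw [add_comm, Int.add_mul_ediv_left _ _ hMc0z, Int.ediv_eq_zero_of_lt (by positivity) (by exact_mod_cast hrem i), zero_add]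
  -- (2) it covers `c₋`
  have hcov : coverAt (F.P K) (k + 1) ŷ = c.src := by
    funext i
    rw [coverAt_apply]
    have h1 : (((a i).valMinAbs : ℤ) : ZMod (Sect2.domCount (F.P K) Mc (k + 1))) = ((((a i).val : ℕ) : ℤ) : ZMod (Sect2.domCount (F.P K) Mc (k + 1))) := by
      rw [ZMod.coe_valMinAbs, Int.cast_natCast, ZMod.natCast_zmod_val]
    obtain ⟨t, ht⟩ := (ZMod.intCast_eq_intCast_iff_dvd_sub _ _ _).1 h1.symm
    have hval : (a i).val = (c.src i).val / Mc := val_cubeOfSite hMc hK c.src i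
    have hdm := Nat.div_add_mod (c.src i).val Mc
    have hNz : (((F.P K).sitesPerDir (k + 1) : ℕ) : ℤ) = (Sect2.domCount (F.P K) Mc (k + 1) : ℤ) * (Mc : ℤ) := by rw [hN, Nat.cast_mul]
    have hy : ŷ i = ((c.src i).val : ℤ) + (((F.P K).sitesPerDir (k + 1) : ℕ) : ℤ) * t := by
      show (Mc : ℤ) * (a i).valMinAbs + (((c.src i).val % Mc : ℕ) : ℤ) = _
      have e1 : ((a i).valMinAbs : ℤ) = ((a i).val : ℤ) + (Sect2.domCount (F.P K) Mc (k + 1) : ℤ) * t := by linarith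
      have e2 : ((c.src i).val : ℤ) = (Mc : ℤ) * (((c.src i).val / Mc : ℕ) : ℤ) + (((c.src i).val % Mc : ℕ) : ℤ) := by exact_mod_cast hdm.symm
      rw [hNz, e1, hval, e2]; ring
    rw [hy, Int.cast_add, Int.cast_mul, Int.cast_natCast, Int.cast_natCast, ZMod.natCast_self, zero_mul, add_zero, ZMod.natCast_zmod_val]
  -- (3) the cube of `c₊` in direction `μ = c.dir`: `⌊(val + 1) ∕ Mc⌋` read modulo `q`
  have htgt_val : (c.tgt c.dir).val = ((c.src c.dir).val + 1) % ((F.P K).sitesPerDir (k + 1)) := by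
    simp only [PBond.tgt, Site.shift, Function.update_self]
    rw [ZMod.val_add, ZMod.val_one]
  have hcube_tgt_dir : cubeOfSite F Mc k K c.tgt c.dir = ((((c.src c.dir).val + 1) / Mc : ℕ) : ZMod (Sect2.domCount (F.P K) Mc (k + 1))) := by
    have hN' : Mc * Sect2.domCount (F.P K) Mc (k + 1) = (F.P K).sitesPerDir (k + 1) := by rw [hN, mul_comm]
    have e := Nat.mod_mul_right_div_self ((c.src c.dir).val + 1) Mc (Sect2.domCount (F.P K) Mc (k + 1))
    rw [hN'] at e
    simp only [cubeOfSite]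
    rw [htgt_val, e, ZMod.natCast_mod]
  have hcube_tgt_off : ∀ i, i ≠ c.dir → cubeOfSite F Mc k K c.tgt i = a i := by
    intro i hi
    simp only [ha, cubeOfSite, PBond.tgt, Site.shift, Function.update_of_ne hi]
  -- (4) the `Mc`-block of `ŷ + e_μ` is the centred representative of the cube of `c₊`
  have hval : (a c.dir).val = (c.src c.dir).val / Mc := val_cubeOfSite hMc hK c.src c.dir
  have hdm := Nat.div_add_mod (c.src c.dir).val Mc
  have hsplit : (c.src c.dir).val + 1 = Mc * ((c.src c.dir).val / Mc) + ((c.src c.dir).val % Mc + 1) := by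
    conv_lhs => rw [← hdm]
    rw [add_assoc]
  have hblk' : blockMap Mc (ŷ + e c.dir) = fun i => (cubeOfSite F Mc k K c.tgt i).valMinAbs := by
    funext i
    by_cases hi : i = c.dir
    · subst hi
      show ((Mc : ℤ) * (a c.dir).valMinAbs + (((c.src c.dir).val % Mc : ℕ) : ℤ) + e c.dir c.dir) / (Mc : ℤ) = (cubeOfSite F Mc k K c.tgt c.dir).valMinAbs
      rw [e_apply, if_pos rfl, hcube_tgt_dir]
      by_cases hwrap : (c.src c.dir).val % Mc + 1 < Mc
      · -- same cube
        have hdiv : ((c.src c.dir).val + 1) / Mc = (c.src c.dir).val / Mc := by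
          rw [hsplit, Nat.mul_add_div hMc0, Nat.div_eq_of_lt hwrap, add_zero]
        rw [hdiv, ← hval, ZMod.natCast_zmod_val,
          show (Mc : ℤ) * (a c.dir).valMinAbs + (((c.src c.dir).val % Mc : ℕ) : ℤ) + 1 = ((((c.src c.dir).val % Mc : ℕ) : ℤ) + 1) + (Mc : ℤ) * (a c.dir).valMinAbs by ring,
          Int.add_mul_ediv_left _ _ hMc0z, Int.ediv_eq_zero_of_lt (by positivity) (by exact_mod_cast hwrap), zero_add]
      · -- the next cube: the remainder is `Mc − 1`
        have hr1 : (c.src c.dir).val % Mc + 1 = Mc := by have := hrem c.dir; omega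
        have hdiv : ((c.src c.dir).val + 1) / Mc = (c.src c.dir).val / Mc + 1 := by
          rw [hsplit, hr1, ← Nat.mul_succ, Nat.mul_div_cancel_left _ hMc0]
        rw [hdiv, Nat.cast_add, Nat.cast_one, ← hval, ZMod.natCast_zmod_val, valMinAbs_add_one_of_ne_half _ ((not_onSeamCtr_iff _).1 hsrc_off c.dir)]
        have e1 : (Mc : ℤ) * (a c.dir).valMinAbs + (((c.src c.dir).val % Mc : ℕ) : ℤ) + 1 = (Mc : ℤ) * ((a c.dir).valMinAbs + 1) := by
          have : ((((c.src c.dir).val % Mc : ℕ) : ℤ)) + 1 = Mc := by exact_mod_cast hr1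
          linear_combination this
        rw [e1, Int.mul_ediv_cancel_left _ hMc0z]
    · show ((Mc : ℤ) * (a i).valMinAbs + (((c.src i).val % Mc : ℕ) : ℤ) + e c.dir i) / (Mc : ℤ) = (cubeOfSite F Mc k K c.tgt i).valMinAbs
      rw [e_apply, if_neg hi, add_zero, hcube_tgt_off i hi, add_comm, Int.add_mul_ediv_left _ _ hMc0z, Int.ediv_eq_zero_of_lt (by positivity) (by exact_mod_cast hrem i),
        zero_add]
  refine ⟨(ŷ, c.dir), ?_, ?_⟩
  · -- membership in `coarseBondsOf`
    unfold coarseBondsOf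
    refine Finset.mem_filter.2 ⟨Finset.mem_product.2 ⟨Finset.mem_biUnion.2 ⟨fun i => (a i).valMinAbs, ?_, ?_⟩, Finset.mem_univ _⟩, ?_⟩
    · exact Finset.mem_image.2 ⟨a, by rw [hXval]; exact Finset.mem_insert_self _ _, rfl⟩
    · show ŷ ∈ blockSites Mc (fun i => (a i).valMinAbs)
      rw [mem_blockSites_iff, hblk]
    · show ({blockMap Mc ŷ, blockMap Mc (ŷ + e c.dir)} : Finset _) = (X.1 : Finset _).image (fun c i => (c i).valMinAbs)
      rw [hXval, Finset.image_insert, Finset.image_singleton, hblk, hblk']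
  · show (⟨coverAt (F.P K) (k + 1) ŷ, c.dir⟩ : PBond (F.P K) (k + 1)) = c
    rw [hcov]

variable {F} in
open scoped Classical in
/-- ★★★ **OFF THE WRAP CLASS, THE INTEGER FORMULA READ THROUGH THE COVER IS THE TORUS PIECE**: `Ψ_jac(X̂_K(X))(φ ∘ π) = E_T(X, φ)` for every pair `φ` on `T_K` — the universal-cover bridge
`J_T(π ĉ, 𝐔) = J_ℤ(ĉ, 𝐔 ∘ π)` summed over the bijection `ĉ ↦ π ĉ` between the integer coarse bonds of `X̂_K(X)` and the coarse bonds `c` with `X(c) = X`. [cite: Balaban1987RG1, (1.21) p.264, (1.7) p.261] -/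
theorem ΨjacRaw_intCubes_pullPair {Mc k K : ℕ} (hMc : McGuard F Mc) (hK : recordK₀ F Mc k ≤ K) {X : (recordDomSys F Mc k K).Dom}
    (hX : X ∉ recordWrapCtr F Mc k K) (φ : Sect2.CPair (F.P K) (MatA 2)) :
    ΨjacRaw F Mc k (intCubes F Mc k K X) (pullPair F K φ) = jacPieceT F Mc k K X φ := by
  have hk : k + 1 ≤ (F.P K).m + (F.P K).K := by rw [F.P_K]; unfold recordK₀ at hK; omega
  unfold ΨjacRaw jacPieceT
  congr 1
  refine Finset.sum_nbij (fun ĉ => coverBondAt (F.P K) (k + 1) ĉ) (fun ĉ hĉ => ?_) (fun ĉ hĉ ĉ' hĉ' h => ?_) (fun c hc => ?_) (fun ĉ _ => ?_)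
  · exact Finset.mem_filter.2 ⟨Finset.mem_univ _, domOfBond_coverBondAt_of_mem_coarseBondsOf hMc hK X hĉ⟩
  · have h1 : ĉ.1 = ĉ'.1 := coverAt_injOn_blockSites_intCubes hMc hK hX (Finset.mem_product.1 (Finset.mem_filter.1 hĉ).1).1
      (Finset.mem_product.1 (Finset.mem_filter.1 hĉ').1).1 (congrArg PBond.src h)
    exact Prod.ext h1 (congrArg PBond.dir h)
  · obtain ⟨ĉ, hĉ, rfl⟩ := exists_mem_coarseBondsOf_coverBondAt_eq hMc hK hX c (Finset.mem_filter.1 (Finset.mem_coe.1 hc)).2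
    exact ⟨ĉ, Finset.mem_coe.2 hĉ, rfl⟩
  · rw [jacTorus_coverBondAt hk, jacTorus_coverBondAt hk]
    rfl

variable {F} in
/-- The pull-back piece of `Ψ_jac` at `X` IS the torus piece (off the wrap class). [cite: Balaban1987RG1, (1.21) p.264, (1.7) p.261] -/
theorem piece_ΨjacRaw_eq_jacPieceT {Mc k K : ℕ} (hMc : McGuard F Mc) (hK : recordK₀ F Mc k ≤ K) {X : (recordDomSys F Mc k K).Dom}
    (hX : X ∉ recordWrapCtr F Mc k K) (φ : Sect2.CPair (F.P K) (MatA 2)) :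
    (ΨjacRaw F Mc k).piece F Mc k K X φ = jacPieceT F Mc k K X φ :=
  ΨjacRaw_intCubes_pullPair hMc hK hX φ

/-- ★★ **ROW (a) OFF THE WRAP CLASS from the per-bond rows.** [cite: Balaban1987RG1, (1.18) p.263, (1.21) p.264] -/
theorem analyticOnUcOff_ΨjacRaw {Mc : ℕ} (hMc : McGuard F Mc) (k : ℕ) {α₀ α₁ : ℝ}
    (hA : ∀ (n : ℕ) (c : PBond (F.P (recordK₀ F Mc k + n)) (k + 1)) (φ : Sect2.CPair (F.P (recordK₀ F Mc k + n)) (MatA 2)),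
      encodeCfg F (recordK₀ F Mc k + n) φ ∈ recordUc F Mc k α₀ α₁ (recordK₀ F Mc k + n) (domOfBond F Mc k (recordK₀ F Mc k + n) c) →
        AnalyticAt ℂ (fun ψ : Sect2.CPair (F.P (recordK₀ F Mc k + n)) (MatA 2) => jacTorus k c ψ.1) φ) :
    (ΨjacRaw F Mc k).AnalyticOnUcOff F Mc k α₀ α₁ := by
  intro n X hX φ hφ
  have hfun : (fun ψ => (ΨjacRaw F Mc k).piece F Mc k (recordK₀ F Mc k + n) X ψ) = fun ψ => jacPieceT F Mc k (recordK₀ F Mc k + n) X ψ :=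
    funext fun ψ => piece_ΨjacRaw_eq_jacPieceT hMc (Nat.le_add_right _ n) hX ψ
  rw [hfun]
  exact analyticAt_jacPieceT X φ fun c hc => hA n c φ (by rw [hc]; exact hφ)

/-- ★★ **ROW (b) OFF THE WRAP CLASS from the per-bond rows**, constants `E₁ = 8 Mc⁴ E e^κ`, any `κ ≥ 0`. [cite: Balaban1987RG1, (1.18) p.263, (1.21) p.264] -/
theorem bound118OnUcOff_ΨjacRaw {Mc : ℕ} (hMc : McGuard F Mc) (k : ℕ) {α₀ α₁ E κ : ℝ} (hE : 0 ≤ E) (hκ : 0 ≤ κ)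
    (hB : ∀ (n : ℕ) (c : PBond (F.P (recordK₀ F Mc k + n)) (k + 1)) (φ : Sect2.CPair (F.P (recordK₀ F Mc k + n)) (MatA 2)),
      encodeCfg F (recordK₀ F Mc k + n) φ ∈ recordUc F Mc k α₀ α₁ (recordK₀ F Mc k + n) (domOfBond F Mc k (recordK₀ F Mc k + n) c) →
        ‖jacTorus k c φ.1 - jacTorus k c 1‖ ≤ E) :
    (ΨjacRaw F Mc k).Bound118OnUcOff F Mc k α₀ α₁ (8 * (Mc : ℝ) ^ 4 * E * Real.exp κ) κ := by
  intro n X hX φ hφ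
  rw [piece_ΨjacRaw_eq_jacPieceT hMc (Nat.le_add_right _ n) hX φ]
  exact norm_jacPieceT_le_exp hMc (Nat.le_add_right _ n) X φ hE hκ fun c hc => hB n c φ (by rw [hc]; exact hφ)

end OffWrap

end Summit.QuantumFields.YangMills.Theorems.BalabanUVNodesPortS1

end
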